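import Literature.NumberTheory.QuadraticFields.RingClassNumber
import Mathlib.Data.ZMod.Units
import HarnessLib

/-!
# Units of `𝓞 K / f𝓞 K` for a quadratic field: reduction to the norm form modulo `f`

Topic `NumberTheory/QuadraticFields`, namespace `Literature.NumberTheory.QuadraticFields.RingClass`
(continuing `RingClassGroup.lean`: norm form `nm`, conjugation `cj` on an integral basis `(1, ω)`,
`ω² = m + tω`). Everything here is PROVED (theorems only).

* `isUnit_mk_iff_isCoprime_nm` — **`x` is a unit modulo `f𝓞 K` iff `gcd(N(x), f) = 1`** (`⇐`: the inverse is
  `x̄ · N(x)⁻¹`; `⇒`: `N` is multiplicative);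
* `isUnit_intCast_zmod_iff` — `(n : ZMod f)` is a unit iff `gcd(n, f) = 1`;
* `card_units_quot_eq_card_normUnitPairs` — **`#(𝓞 K/f𝓞 K)ˣ = #{(u, v) ∈ (ℤ/f)² : u² + tuv − mv² ∈ (ℤ/f)ˣ}`**
  (coordinates on the basis `(1, ω)`): the first step of the count `|(𝓞 K/f)ˣ| = φ(f)∏ p^{k−1}(p − χ(p))`
  in Cox's Thm. 7.24 (Exercise 7.29), finished in `RingClassQuotUnitsCount.lean`.

## References

* D. A. Cox, *Primes of the form x² + ny²*, 2nd ed., Wiley (2013), §7.D Thm. 7.24 and Exercise 7.29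
  (the order of `(𝒪_K/f𝒪_K)^*`). [cite: Cox2013, §7.D Thm. 7.24]
-/

noncomputable section

open scoped nonZeroDivisors
open Module NumberField
open Literature.NumberTheory.QuadraticFields.Quadratic

namespace Literature.NumberTheory.QuadraticFields.RingClass

variable {K : Type*} [Field K] [NumberField K] {f : ℕ}
variable (b : Basis (Fin 2) ℤ (𝓞 K)) (hb : b 0 = 1) {t m : ℤ}
  (hω : b 1 * b 1 = (m : 𝓞 K) + (t : 𝓞 K) * b 1)

/-! ### Units modulo `f` and the norm form -/

include hb hω in
/-- **`x` is invertible modulo `f𝓞 K` iff `N(x)` is prime to `f`.** [cite: Cox2013, §7.D Exercise 7.29] -/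
theorem isUnit_mk_iff_isCoprime_nm (x : 𝓞 K) :
    IsUnit (Ideal.Quotient.mk (Ideal.span {(f : 𝓞 K)}) x) ↔ IsCoprime (nm b (t := t) (m := m) x) (f : ℤ) := by
  constructor
  · exact isCoprime_nm_of_isUnit b hb hω
  · rintro ⟨u, v, huv⟩
    refine IsUnit.of_mul_eq_one (Ideal.Quotient.mk _ (cj b (t := t) x * (u : 𝓞 K))) ?_
    rw [← map_mul, ← (Ideal.Quotient.mk _).map_one, Ideal.Quotient.eq, ← mul_assoc, mul_cj b hb hω (m := m)]
    have : (nm b (t := t) (m := m) x : 𝓞 K) * (u : 𝓞 K) - 1 = -((v : 𝓞 K) * (f : 𝓞 K)) := by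
      have := congrArg (Int.cast : ℤ → 𝓞 K) huv
      push_cast at this
      linear_combination this
    rw [this]
    exact Submodule.neg_mem _ (Ideal.mul_mem_left _ _ (Ideal.mem_span_singleton_self _))

/-- `(n : ZMod f)` is a unit iff `gcd(n, f) = 1` (Mathlib, reoriented). [cite: Cox2013, §7.D (7.27) ((ℤ/fℤ)ˣ)] -/
theorem isUnit_intCast_zmod_iff (n : ℤ) : IsUnit ((n : ℤ) : ZMod f) ↔ IsCoprime n (f : ℤ) := by
  rw [ZMod.coe_int_isUnit_iff_isCoprime, isCoprime_comm]

/-! ### Units of `𝓞 K/f𝓞 K` and pairs modulo `f` with invertible norm -/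

omit [NumberField K] in
include hb in
/-- An element of `𝓞 K` with both coordinates divisible by `f` lies in `f𝓞 K`. [cite: Cox2013, §7.A Lemma 7.2] -/
theorem mem_span_of_dvd_repr {x : 𝓞 K} (h0 : (f : ℤ) ∣ b.repr x 0) (h1 : (f : ℤ) ∣ b.repr x 1) :
    x ∈ Ideal.span {(f : 𝓞 K)} := by
  obtain ⟨c0, hc0⟩ := h0
  obtain ⟨c1, hc1⟩ := h1
  rw [eq_repr_add_repr_mul_of_basis b hb x, hc0, hc1]
  refine Ideal.mem_span_singleton'.2 ⟨(c0 : 𝓞 K) + (c1 : 𝓞 K) * b 1, ?_⟩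
  push_cast; ring

omit [NumberField K] in
/-- Coordinates of congruent elements agree modulo `f`. [cite: Cox2013, §7.A Lemma 7.2] -/
theorem intCast_repr_eq_of_sub_mem {x y : 𝓞 K} (h : x - y ∈ Ideal.span {(f : 𝓞 K)}) (i : Fin 2) :
    ((b.repr x i : ℤ) : ZMod f) = ((b.repr y i : ℤ) : ZMod f) := by
  have hd := dvd_repr_of_mem_span b h i
  rw [map_sub, Finsupp.sub_apply] at hd
  exact ((ZMod.intCast_eq_intCast_iff_dvd_sub _ _ _).2 (by simpa using hd)).symm

omit [NumberField K] in
/-- The norm form computed modulo `f` on coordinates. [cite: Cox2013, §7.A (7.1)] -/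
theorem intCast_nm (x : 𝓞 K) :
    ((nm b (t := t) (m := m) x : ℤ) : ZMod f) =
      ((b.repr x 0 : ℤ) : ZMod f) ^ 2 + (t : ZMod f) * ((b.repr x 0 : ℤ) : ZMod f) * ((b.repr x 1 : ℤ) : ZMod f) -
        (m : ZMod f) * ((b.repr x 1 : ℤ) : ZMod f) ^ 2 := by
  rw [nm]; push_cast; ring

include hb hω in
/-- **`#(𝓞 K/f𝓞 K)ˣ = #{(u, v) ∈ (ℤ/f)² : u² + tuv − mv² ∈ (ℤ/f)ˣ}`.** The bijection is
`[x] ↦ (x₀, x₁) mod f` on the basis `(1, ω)`. [cite: Cox2013, §7.D Thm. 7.24 and Exercise 7.29] -/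
theorem card_units_quot_eq_card_normUnitPairs :
    Nat.card (𝓞 K ⧸ Ideal.span {(f : 𝓞 K)})ˣ =
      Nat.card {uv : ZMod f × ZMod f //
        IsUnit (uv.1 ^ 2 + (t : ZMod f) * uv.1 * uv.2 - (m : ZMod f) * uv.2 ^ 2)} := by
  classical
  -- the map on units via chosen lifts
  have hwd : ∀ x : (𝓞 K ⧸ Ideal.span {(f : 𝓞 K)})ˣ,
      IsUnit ((((b.repr (liftU x) 0 : ℤ) : ZMod f)) ^ 2 + (t : ZMod f) * ((b.repr (liftU x) 0 : ℤ) : ZMod f) *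
        ((b.repr (liftU x) 1 : ℤ) : ZMod f) - (m : ZMod f) * ((b.repr (liftU x) 1 : ℤ) : ZMod f) ^ 2) := by
    intro x
    rw [← intCast_nm b, isUnit_intCast_zmod_iff]
    exact (isUnit_mk_iff_isCoprime_nm b hb hω _).1 (isUnit_mk_liftU x)
  let Φ : (𝓞 K ⧸ Ideal.span {(f : 𝓞 K)})ˣ →
      {uv : ZMod f × ZMod f // IsUnit (uv.1 ^ 2 + (t : ZMod f) * uv.1 * uv.2 - (m : ZMod f) * uv.2 ^ 2)} :=
    fun x => ⟨(((b.repr (liftU x) 0 : ℤ) : ZMod f), ((b.repr (liftU x) 1 : ℤ) : ZMod f)), hwd x⟩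
  refine Nat.card_eq_of_bijective Φ ⟨?_, ?_⟩
  · intro x y hxy
    have h0 : ((b.repr (liftU x) 0 : ℤ) : ZMod f) = ((b.repr (liftU y) 0 : ℤ) : ZMod f) :=
      congrArg (fun p => p.1.1) hxy
    have h1 : ((b.repr (liftU x) 1 : ℤ) : ZMod f) = ((b.repr (liftU y) 1 : ℤ) : ZMod f) :=
      congrArg (fun p => p.1.2) hxy
    apply Units.ext
    rw [← mk_liftU x, ← mk_liftU y, Ideal.Quotient.eq]
    apply mem_span_of_dvd_repr b hb
    · rw [map_sub, Finsupp.sub_apply]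
      exact (ZMod.intCast_eq_intCast_iff_dvd_sub _ _ _).1 h0.symm
    · rw [map_sub, Finsupp.sub_apply]
      exact (ZMod.intCast_eq_intCast_iff_dvd_sub _ _ _).1 h1.symm
  · rintro ⟨⟨u, v⟩, huv⟩
    obtain ⟨U, rfl⟩ := ZMod.intCast_surjective u
    obtain ⟨V, rfl⟩ := ZMod.intCast_surjective v
    set x : 𝓞 K := (U : 𝓞 K) + (V : 𝓞 K) * b 1 with hx
    have hx0 : b.repr x 0 = U := repr_intCast_add_intCast_mul_zero b hb U V
    have hx1 : b.repr x 1 = V := repr_intCast_add_intCast_mul_one b hb U V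
    have hxu : IsUnit (Ideal.Quotient.mk (Ideal.span {(f : 𝓞 K)}) x) := by
      rw [isUnit_mk_iff_isCoprime_nm b hb hω, ← isUnit_intCast_zmod_iff, intCast_nm b, hx0, hx1]
      exact huv
    refine ⟨hxu.unit, ?_⟩
    apply Subtype.ext
    have hcong : liftU hxu.unit - x ∈ Ideal.span {(f : 𝓞 K)} := by
      rw [← Ideal.Quotient.eq, mk_liftU, IsUnit.unit_spec]
    simp only [Φ, Prod.mk.injEq]
    rw [intCast_repr_eq_of_sub_mem b hcong 0, intCast_repr_eq_of_sub_mem b hcong 1, hx0, hx1]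
    exact ⟨rfl, rfl⟩

end Literature.NumberTheory.QuadraticFields.RingClass
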